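import Mathlib.Algebra.MvPolynomial.Equiv
import Mathlib.Algebra.MvPolynomial.Monad
import Mathlib.Algebra.Polynomial.AlgebraMap
import Mathlib.Algebra.Polynomial.Div
import Mathlib.RingTheory.Coprime.Basic
import Mathlib.Algebra.Algebra.Rat
import Mathlib.Data.Real.Basic
import HarnessLib

/-!
# Stokes descent for the dilation pencil, I: the exact quotient (algebra)

For a rational function `B = P/Q` of `1 + d` variables (`P, Q ∈ ℚ[x₀, x₁, …, x_d]`) the polynomial
  `N(t,u) := (P(t,u)Q(0,u) − P(0,u)Q(t,u))·Q(1,u) − t·(P(1,u)Q(0,u) − P(0,u)Q(1,u))·Q(t,u)`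
(the numerator of `(B(t,u) − B(0,u)) − t(B(1,u) − B(0,u))`) vanishes identically at `t = 0` and
at `t = 1`, hence `N = t(t − 1)·N₁` for a polynomial `N₁ ∈ ℚ[x₀, …, x_d]` (`exists_stokes_quotient`;
proof: pass to `ℚ[x₁..x_d][t]` by `MvPolynomial.finSuccEquiv` and divide by the coprime factors `t`,
`t − 1`). This is the algebraic half of the Stokes descent
`v_{∂₀B} ≡ v_{B(1,·) − B(0,·)} (mod (ϖ − 1)·D')` for the dilation lifting problem at `1`
(route `KontsevichZagierPeriods/LiftingCriteria`, crux `DilationLiftAtOne`): the quotient `N₁` is the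
numerator of the twisted kernel, which is therefore again a regular rational function (no analytic
division is needed).

Everything is proved; no `def`, no named fact.

## References
* standard algebra. [folklore]
-/

noncomputable section

open scoped BigOperators

namespace Literature.NumberTheory.Transcendental

namespace KZ.StokesDescent

variable {d : ℕ}

/-- `aevalTower g y p = p.eval₂ g y`. [folklore] -/
theorem aevalTower_apply {R S A : Type*} [CommSemiring R] [CommSemiring S] [CommSemiring A]
    [Algebra S R] [Algebra S A] (g : R →ₐ[S] A) (y : A) (p : Polynomial R) :
    Polynomial.aevalTower g y p = p.eval₂ (g : R →+* A) y := rfl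

/-- Evaluation of a `(1+d)`-variable polynomial at `Fin.cons t u` through `finSuccEquiv`:
`f(t,u) = Σ_k f_k(u) t^k`. [folklore] -/
theorem aeval_cons_eq_aevalTower (t : ℝ) (u : Fin d → ℝ) (f : MvPolynomial (Fin (d + 1)) ℚ) :
    MvPolynomial.aeval (Fin.cons t u : Fin (d + 1) → ℝ) f =
      Polynomial.aevalTower (MvPolynomial.aeval u) t (MvPolynomial.finSuccEquiv ℚ d f) := by
  have h : (MvPolynomial.aeval (Fin.cons t u : Fin (d + 1) → ℝ) :
      MvPolynomial (Fin (d + 1)) ℚ →ₐ[ℚ] ℝ) =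
      (Polynomial.aevalTower (MvPolynomial.aeval u) t).comp
        (MvPolynomial.finSuccEquiv ℚ d).toAlgHom := by
    apply MvPolynomial.algHom_ext
    intro i
    refine Fin.cases ?_ (fun j => ?_) i
    · simp [MvPolynomial.finSuccEquiv_X_zero]
    · simp [MvPolynomial.finSuccEquiv_X_succ]
  exact AlgHom.congr_fun h f

/-- The value of `finSuccEquiv f` at a rational height `c` is the face polynomial
`f(c, x₁, …, x_d)`. [folklore] -/
theorem eval_finSuccEquiv_C (f : MvPolynomial (Fin (d + 1)) ℚ) (c : ℚ) :
    (MvPolynomial.finSuccEquiv ℚ d f).eval (MvPolynomial.C c) =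
      MvPolynomial.bind₁ (Fin.cons (MvPolynomial.C c) MvPolynomial.X :
        Fin (d + 1) → MvPolynomial (Fin d) ℚ) f := by
  have h : ((Polynomial.aeval (R := MvPolynomial (Fin d) ℚ)
      (MvPolynomial.C c : MvPolynomial (Fin d) ℚ)).restrictScalars ℚ).comp
        (MvPolynomial.finSuccEquiv ℚ d).toAlgHom =
      MvPolynomial.aeval (Fin.cons (MvPolynomial.C c) MvPolynomial.X :
        Fin (d + 1) → MvPolynomial (Fin d) ℚ) := by
    apply MvPolynomial.algHom_ext
    intro i
    refine Fin.cases ?_ (fun j => ?_) i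
    · simp [MvPolynomial.finSuccEquiv_X_zero]
    · simp [MvPolynomial.finSuccEquiv_X_succ]
  have hf := AlgHom.congr_fun h f
  simp only [AlgHom.comp_apply, AlgHom.restrictScalars_apply, Polynomial.coe_aeval_eq_eval,
    AlgEquiv.coe_toAlgHom] at hf
  rw [hf]
  rfl

/-- Evaluating the face polynomial: `(f(c,·))(u) = f(c, u)`. [folklore] -/
theorem aeval_bind₁_cons (u : Fin d → ℝ) (f : MvPolynomial (Fin (d + 1)) ℚ) (c : ℚ) :
    MvPolynomial.aeval u (MvPolynomial.bind₁ (Fin.cons (MvPolynomial.C c) MvPolynomial.X :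
        Fin (d + 1) → MvPolynomial (Fin d) ℚ) f) =
      MvPolynomial.aeval (Fin.cons (c : ℝ) u : Fin (d + 1) → ℝ) f := by
  rw [MvPolynomial.aeval_bind₁]
  congr 1
  ext i
  refine Fin.cases ?_ (fun j => ?_) i
  · simp
  · simp

/-- Evaluating a coefficient value at a rational height: `(finSuccEquiv f)(c)` evaluated at `u` is
`f(c,u)`. [folklore] -/
theorem aeval_eval_finSuccEquiv_C (u : Fin d → ℝ) (f : MvPolynomial (Fin (d + 1)) ℚ) (c : ℚ) :
    MvPolynomial.aeval u ((MvPolynomial.finSuccEquiv ℚ d f).eval (MvPolynomial.C c)) =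
      MvPolynomial.aeval (Fin.cons (c : ℝ) u : Fin (d + 1) → ℝ) f := by
  rw [eval_finSuccEquiv_C, aeval_bind₁_cons]

/-- **The Stokes quotient.** For `P, Q ∈ ℚ[x₀, …, x_d]` there is `N₁ ∈ ℚ[x₀, …, x_d]` with
`(P(t,u)Q(0,u) − P(0,u)Q(t,u))Q(1,u) − t(P(1,u)Q(0,u) − P(0,u)Q(1,u))Q(t,u) = t(t − 1)N₁(t,u)`
for all real `(t,u)`. [folklore] -/
theorem exists_stokes_quotient (P Q : MvPolynomial (Fin (d + 1)) ℚ) :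
    ∃ N₁ : MvPolynomial (Fin (d + 1)) ℚ, ∀ (t : ℝ) (u : Fin d → ℝ),
      (MvPolynomial.aeval (Fin.cons t u : Fin (d + 1) → ℝ) P *
            MvPolynomial.aeval (Fin.cons 0 u : Fin (d + 1) → ℝ) Q -
          MvPolynomial.aeval (Fin.cons 0 u : Fin (d + 1) → ℝ) P *
            MvPolynomial.aeval (Fin.cons t u : Fin (d + 1) → ℝ) Q) *
          MvPolynomial.aeval (Fin.cons 1 u : Fin (d + 1) → ℝ) Q -
        t * (MvPolynomial.aeval (Fin.cons 1 u : Fin (d + 1) → ℝ) P *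
              MvPolynomial.aeval (Fin.cons 0 u : Fin (d + 1) → ℝ) Q -
            MvPolynomial.aeval (Fin.cons 0 u : Fin (d + 1) → ℝ) P *
              MvPolynomial.aeval (Fin.cons 1 u : Fin (d + 1) → ℝ) Q) *
          MvPolynomial.aeval (Fin.cons t u : Fin (d + 1) → ℝ) Q =
      t * (t - 1) * MvPolynomial.aeval (Fin.cons t u : Fin (d + 1) → ℝ) N₁ := by
  classical
  set φ := MvPolynomial.finSuccEquiv ℚ d with hφ
  set p : Polynomial (MvPolynomial (Fin d) ℚ) := φ P with hp
  set q : Polynomial (MvPolynomial (Fin d) ℚ) := φ Q with hq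
  -- the numerator polynomial over `ℚ[x₁..x_d]`
  set Nt : Polynomial (MvPolynomial (Fin d) ℚ) :=
    (p * Polynomial.C (q.eval (MvPolynomial.C 0)) - Polynomial.C (p.eval (MvPolynomial.C 0)) * q) *
        Polynomial.C (q.eval (MvPolynomial.C 1)) -
      Polynomial.X * Polynomial.C (p.eval (MvPolynomial.C 1) * q.eval (MvPolynomial.C 0) -
        p.eval (MvPolynomial.C 0) * q.eval (MvPolynomial.C 1)) * q with hNt
  have h0 : Nt.eval 0 = 0 := by
    simp only [hNt, Polynomial.eval_sub, Polynomial.eval_mul, Polynomial.eval_C, Polynomial.eval_X,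
      MvPolynomial.C_0, MvPolynomial.C_1]
    ring
  have h1 : Nt.eval 1 = 0 := by
    simp only [hNt, Polynomial.eval_sub, Polynomial.eval_mul, Polynomial.eval_C, Polynomial.eval_X,
      MvPolynomial.C_0, MvPolynomial.C_1]
    ring
  have hX : Polynomial.X ∣ Nt := by
    rw [Polynomial.X_dvd_iff, Polynomial.coeff_zero_eq_eval_zero]
    exact h0
  have hX1 : Polynomial.X - Polynomial.C 1 ∣ Nt := Polynomial.dvd_iff_isRoot.mpr h1
  have hcop : IsCoprime (Polynomial.X : Polynomial (MvPolynomial (Fin d) ℚ))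
      (Polynomial.X - Polynomial.C 1) :=
    ⟨1, -1, by rw [map_one]; ring⟩
  obtain ⟨N1t, hN⟩ := hcop.mul_dvd hX hX1
  refine ⟨φ.symm N1t, fun t u => ?_⟩
  -- evaluate the identity `Nt = X (X − 1) N1t` at `(t, u)`
  have hev := congrArg (Polynomial.aevalTower (MvPolynomial.aeval u) t) hN
  simp only [map_mul, map_sub, Polynomial.aevalTower_X, map_one] at hev
  have hN1 : Polynomial.aevalTower (MvPolynomial.aeval u) t N1t =
      MvPolynomial.aeval (Fin.cons t u : Fin (d + 1) → ℝ) (φ.symm N1t) := by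
    rw [aeval_cons_eq_aevalTower, ← hφ, AlgEquiv.apply_symm_apply]
  have hP : Polynomial.aevalTower (MvPolynomial.aeval u) t p =
      MvPolynomial.aeval (Fin.cons t u : Fin (d + 1) → ℝ) P := by
    rw [aeval_cons_eq_aevalTower]
  have hQ : Polynomial.aevalTower (MvPolynomial.aeval u) t q =
      MvPolynomial.aeval (Fin.cons t u : Fin (d + 1) → ℝ) Q := by
    rw [aeval_cons_eq_aevalTower]
  have hP0 : MvPolynomial.aeval u (p.eval (MvPolynomial.C 0)) =
      MvPolynomial.aeval (Fin.cons 0 u : Fin (d + 1) → ℝ) P := by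
    rw [hp, hφ, aeval_eval_finSuccEquiv_C, Rat.cast_zero]
  have hP1 : MvPolynomial.aeval u (p.eval (MvPolynomial.C 1)) =
      MvPolynomial.aeval (Fin.cons 1 u : Fin (d + 1) → ℝ) P := by
    rw [hp, hφ, aeval_eval_finSuccEquiv_C, Rat.cast_one]
  have hQ0 : MvPolynomial.aeval u (q.eval (MvPolynomial.C 0)) =
      MvPolynomial.aeval (Fin.cons 0 u : Fin (d + 1) → ℝ) Q := by
    rw [hq, hφ, aeval_eval_finSuccEquiv_C, Rat.cast_zero]
  have hQ1 : MvPolynomial.aeval u (q.eval (MvPolynomial.C 1)) =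
      MvPolynomial.aeval (Fin.cons 1 u : Fin (d + 1) → ℝ) Q := by
    rw [hq, hφ, aeval_eval_finSuccEquiv_C, Rat.cast_one]
  have hLHS : Polynomial.aevalTower (MvPolynomial.aeval u) t Nt =
      (MvPolynomial.aeval (Fin.cons t u : Fin (d + 1) → ℝ) P *
            MvPolynomial.aeval (Fin.cons 0 u : Fin (d + 1) → ℝ) Q -
          MvPolynomial.aeval (Fin.cons 0 u : Fin (d + 1) → ℝ) P *
            MvPolynomial.aeval (Fin.cons t u : Fin (d + 1) → ℝ) Q) *
          MvPolynomial.aeval (Fin.cons 1 u : Fin (d + 1) → ℝ) Q -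
        t * (MvPolynomial.aeval (Fin.cons 1 u : Fin (d + 1) → ℝ) P *
              MvPolynomial.aeval (Fin.cons 0 u : Fin (d + 1) → ℝ) Q -
            MvPolynomial.aeval (Fin.cons 0 u : Fin (d + 1) → ℝ) P *
              MvPolynomial.aeval (Fin.cons 1 u : Fin (d + 1) → ℝ) Q) *
          MvPolynomial.aeval (Fin.cons t u : Fin (d + 1) → ℝ) Q := by
    simp only [hNt, map_sub, map_mul, Polynomial.aevalTower_C, Polynomial.aevalTower_X, hP, hQ,
      hP0, hP1, hQ0, hQ1]
  rw [← hLHS, hev, hN1]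

end KZ.StokesDescent

end Literature.NumberTheory.Transcendental
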